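import Mathlib
import Literature.Computability.Complexity.SymmetricCircuit
import Summits.PneNP.PneNP.Theorems.SymmetryBudgetWindowBarrierCoreReduction
import Summits.PneNP.PneNP.Theorems.SymmetryBudgetPolylogHamListings

/-!
# Planting a Hamiltonian-path instance on the free part: the square-symmetric core circuit
(helper for item stmt-PneNP-2148 `SymmetryBudget.PolylogHam`, route route-PneNP-SymmetryBudget)

For `m = n + g` vertices, `n` ordered and `g` free, the PLANTED HAM MATRIX of a graph `G` on
`Fin g` is the `m × m` Boolean matrix `x_G` with

* the adjacency matrix of `G` on the free block `{n, …, n+g-1}²`,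
* the path `0 — 1 — ⋯ — (n-1)` on the ordered block,
* the two ends `0`, `n - 1` of that path joined to every free vertex, nothing else.

Read as the route's graph `Gr x = SimpleGraph.fromRel (x (u,v) = true)` it is the planted graph
of `SymmetryBudgetPolylogHamListings.lean`, so for `n ≥ 3`, `g ≥ 1` it is Hamiltonian iff `G`
has a Hamiltonian path (`isHamiltonian_gr_iff`). HARD-WIRING a `Bud(n+g, g)`-symmetric
`tcBasis`-circuit `C` on `m × m` inputs along the wiring "free block ↦ the new `g × g` inputs,
every other entry ↦ the constant gate carrying its planted value" (the type-changing relocation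
calculus `CoreReduction.exists_hardwire₂` of `SymmetryBudgetWindowBarrierRelocation.lean`; the
planted pattern outside the free block is invariant under `Bud`, which fixes the ordered indices)
gives a `Sym(Fin g)`-symmetric (square-symmetric) `tcBasis`-circuit `D` on `g × g` inputs with
two more gates and `D (adjacency matrix of G) = C (x_G)` for every `G` (`exists_hamCore`).
Everything is packaged in ONE existence statement `exists_hamPlant` consumed by the assembly.
Folklore (Anderson–Dawar 2017, §2: restrictions of symmetric circuits; the universal-vertex /
path gadget for Hamiltonian path versus cycle). No definitions are introduced (kernel-only
helper file); the planted matrix is an explicit term with its specification.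
-/

-- `Summit.PneNP.PneNP.…` duplicates `PneNP` BY DESIGN (single-problem summit).
set_option linter.dupNamespace false

namespace Summit.PneNP.PneNP.Theorems

open Literature.Computability.Complexity Literature.Computability.Complexity.GateList Filter
open scoped Classical

namespace PolylogHam

open CoreReduction

section Plant

variable {n g : ℕ}

/-- **The planted graph `Gr x_G` has the adjacency pattern of the listings file**: `G` on the
free block, the path `0 — ⋯ — (n-1)` on the ordered block, the ends `0`, `n-1` joined to all
free vertices (from the four specification clauses of the planted matrix). -/
theorem gr_adj_planted (G : SimpleGraph (Fin g)) (x : Fin (n + g) × Fin (n + g) → Bool)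
    (hFF : ∀ q : Fin (n + g) × Fin (n + g), ∀ h : n ≤ (q.1 : ℕ) ∧ n ≤ (q.2 : ℕ),
      x q = decide (G.Adj ⟨q.1 - n, by omega⟩ ⟨q.2 - n, by omega⟩))
    (hOO : ∀ q : Fin (n + g) × Fin (n + g), (q.1 : ℕ) < n → (q.2 : ℕ) < n →
      x q = decide ((q.1 : ℕ) + 1 = q.2 ∨ (q.2 : ℕ) + 1 = q.1))
    (hOF : ∀ q : Fin (n + g) × Fin (n + g), (q.1 : ℕ) < n → n ≤ (q.2 : ℕ) →
      x q = decide ((q.1 : ℕ) = 0 ∨ (q.1 : ℕ) = n - 1))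
    (hFO : ∀ q : Fin (n + g) × Fin (n + g), n ≤ (q.1 : ℕ) → (q.2 : ℕ) < n →
      x q = decide ((q.2 : ℕ) = 0 ∨ (q.2 : ℕ) = n - 1)) :
    (∀ j j' : Fin g, (SimpleGraph.fromRel fun u v => x (u, v) = true).Adj
        ⟨n + j, freeIdx_lt n j⟩ ⟨n + j', freeIdx_lt n j'⟩ ↔ G.Adj j j') ∧
    (∀ i i' : Fin (n + g), (i : ℕ) < n → (i' : ℕ) < n →
      ((SimpleGraph.fromRel fun u v => x (u, v) = true).Adj i i' ↔
        (i : ℕ) + 1 = i' ∨ (i' : ℕ) + 1 = i)) ∧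
    (∀ (i : Fin (n + g)) (j : Fin g), (i : ℕ) < n →
      ((SimpleGraph.fromRel fun u v => x (u, v) = true).Adj i ⟨n + j, freeIdx_lt n j⟩ ↔
        (i : ℕ) = 0 ∨ (i : ℕ) = n - 1)) := by
  refine ⟨fun j j' => ?_, fun i i' hi hi' => ?_, fun i j hi => ?_⟩
  · rw [SimpleGraph.fromRel_adj, hFF _ ⟨by simp, by simp⟩, hFF _ ⟨by simp, by simp⟩]
    simp only [Nat.add_sub_cancel_left, Fin.eta, decide_eq_true_eq, ne_eq, Fin.mk.injEq]
    constructor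
    · rintro ⟨-, h | h⟩
      · exact h
      · exact h.symm
    · intro h
      exact ⟨fun e => G.ne_of_adj h (Fin.ext (by omega)), Or.inl h⟩
  · rw [SimpleGraph.fromRel_adj, hOO _ hi hi', hOO _ hi' hi]
    simp only [decide_eq_true_eq, ne_eq]
    constructor
    · rintro ⟨-, h | h⟩ <;> omega
    · intro h
      exact ⟨fun e => by rw [e] at h; omega, Or.inl h⟩
  · rw [SimpleGraph.fromRel_adj, hOF _ hi (by simp), hFO _ (by simp) hi]
    simp only [decide_eq_true_eq, ne_eq, or_self, and_iff_right_iff_imp]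
    intro _ e
    have := congrArg Fin.val e
    simp only at this
    omega

/-- **The planted graph is Hamiltonian iff `G` has a Hamiltonian path** (`n ≥ 3`, `g ≥ 1`). -/
theorem isHamiltonian_gr_iff (hn : 3 ≤ n) (hg : 1 ≤ g) (G : SimpleGraph (Fin g))
    (x : Fin (n + g) × Fin (n + g) → Bool)
    (hFF : ∀ q : Fin (n + g) × Fin (n + g), ∀ h : n ≤ (q.1 : ℕ) ∧ n ≤ (q.2 : ℕ),
      x q = decide (G.Adj ⟨q.1 - n, by omega⟩ ⟨q.2 - n, by omega⟩))
    (hOO : ∀ q : Fin (n + g) × Fin (n + g), (q.1 : ℕ) < n → (q.2 : ℕ) < n →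
      x q = decide ((q.1 : ℕ) + 1 = q.2 ∨ (q.2 : ℕ) + 1 = q.1))
    (hOF : ∀ q : Fin (n + g) × Fin (n + g), (q.1 : ℕ) < n → n ≤ (q.2 : ℕ) →
      x q = decide ((q.1 : ℕ) = 0 ∨ (q.1 : ℕ) = n - 1))
    (hFO : ∀ q : Fin (n + g) × Fin (n + g), n ≤ (q.1 : ℕ) → (q.2 : ℕ) < n →
      x q = decide ((q.2 : ℕ) = 0 ∨ (q.2 : ℕ) = n - 1)) :
    (SimpleGraph.fromRel fun u v => x (u, v) = true).IsHamiltonian ↔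
      ∃ l : List (Fin g), l.Nodup ∧ (∀ v, v ∈ l) ∧ List.IsChain G.Adj l := by
  obtain ⟨h1, h2, h3⟩ := gr_adj_planted G x hFF hOO hOF hFO
  exact planted_isHamiltonian_iff G _ hn hg h1 h2 h3

/-- **The planting wiring for HAM.** On the free block `φ (n+j, n+j') = inl (j, j')`; every other
entry is wired to the constant gate (`0 ↦ true`, `1 ↦ false`, read off the prefix values
`[true, false]`) carrying its planted value. It reads every planted matrix off the adjacency
matrix of its graph and intertwines `ρ × ρ`, for the extension `ρ = id ⊕ σ ∈ Bud` of any
`σ ∈ Sym(Fin g)` (which fixes the ordered indices), with `σ × σ`. -/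
theorem exists_hamWire (n g : ℕ) :
    ∃ φ : Fin (n + g) × Fin (n + g) → (Fin g × Fin g) ⊕ ℕ,
      WiresOK 2 φ ∧
      (∀ (G : SimpleGraph (Fin g)) (x : Fin (n + g) × Fin (n + g) → Bool),
        (∀ q : Fin (n + g) × Fin (n + g), ∀ h : n ≤ (q.1 : ℕ) ∧ n ≤ (q.2 : ℕ),
          x q = decide (G.Adj ⟨q.1 - n, by omega⟩ ⟨q.2 - n, by omega⟩)) →
        (∀ q : Fin (n + g) × Fin (n + g), (q.1 : ℕ) < n → (q.2 : ℕ) < n →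
          x q = decide ((q.1 : ℕ) + 1 = q.2 ∨ (q.2 : ℕ) + 1 = q.1)) →
        (∀ q : Fin (n + g) × Fin (n + g), (q.1 : ℕ) < n → n ≤ (q.2 : ℕ) →
          x q = decide ((q.1 : ℕ) = 0 ∨ (q.1 : ℕ) = n - 1)) →
        (∀ q : Fin (n + g) × Fin (n + g), n ≤ (q.1 : ℕ) → (q.2 : ℕ) < n →
          x q = decide ((q.2 : ℕ) = 0 ∨ (q.2 : ℕ) = n - 1)) →
        ∀ q : Fin (n + g) × Fin (n + g),
          wireOf (fun p : Fin g × Fin g => decide (G.Adj p.1 p.2)) [true, false] (φ q) = x q) ∧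
      ∀ (σ : Equiv.Perm (Fin g)) (ρ : Equiv.Perm (Fin (n + g))),
        (∀ i : Fin (n + g), (i : ℕ) < n → ρ i = i) →
        (∀ i : Fin (n + g), n ≤ ((ρ i : Fin (n + g)) : ℕ) ↔ n ≤ (i : ℕ)) →
        (∀ (i : Fin (n + g)) (h : n ≤ (i : ℕ)), ρ i = ⟨n + σ ⟨i - n, by omega⟩, freeIdx_lt n _⟩) →
        ∀ q : Fin (n + g) × Fin (n + g),
          φ (ρ q.1, ρ q.2) = Sum.map (fun p : Fin g × Fin g => (σ p.1, σ p.2)) id (φ q) := by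
  -- the planted value outside the free block, as a Boolean pattern of the two indices
  let pat : Fin (n + g) × Fin (n + g) → Bool := fun q =>
    if (q.1 : ℕ) < n then
      (if (q.2 : ℕ) < n then decide ((q.1 : ℕ) + 1 = q.2 ∨ (q.2 : ℕ) + 1 = q.1)
        else decide ((q.1 : ℕ) = 0 ∨ (q.1 : ℕ) = n - 1))
    else decide ((q.2 : ℕ) = 0 ∨ (q.2 : ℕ) = n - 1)
  refine ⟨fun q => if h : n ≤ (q.1 : ℕ) ∧ n ≤ (q.2 : ℕ) then
      Sum.inl (⟨q.1 - n, by omega⟩, ⟨q.2 - n, by omega⟩) else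
      Sum.inr (if pat q then 0 else 1), ?_, ?_, ?_⟩
  · intro q k hk
    dsimp only at hk
    split_ifs at hk <;> simp only [Sum.inr.injEq] at hk <;> omega
  · intro G x hFF hOO hOF hFO q
    dsimp only
    by_cases h : n ≤ (q.1 : ℕ) ∧ n ≤ (q.2 : ℕ)
    · rw [dif_pos h, wireOf_inl, hFF q h]
    · rw [dif_neg h]
      have hval : wireOf (fun p : Fin g × Fin g => decide (G.Adj p.1 p.2)) [true, false]
          (Sum.inr (if pat q then 0 else 1)) = pat q := by
        cases pat q <;> rfl
      rw [hval]
      simp only [pat]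
      by_cases h1 : (q.1 : ℕ) < n
      · by_cases h2 : (q.2 : ℕ) < n
        · rw [if_pos h1, if_pos h2, hOO q h1 h2]
        · rw [if_pos h1, if_neg h2, hOF q h1 (by omega)]
      · have h2 : (q.2 : ℕ) < n := by omega
        rw [if_neg h1, hFO q (by omega) h2]
  · intro σ ρ hρfix hρfree hρval q
    dsimp only
    by_cases h : n ≤ (q.1 : ℕ) ∧ n ≤ (q.2 : ℕ)
    · have h' : n ≤ ((ρ q.1 : Fin (n + g)) : ℕ) ∧ n ≤ ((ρ q.2 : Fin (n + g)) : ℕ) :=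
        ⟨(hρfree q.1).2 h.1, (hρfree q.2).2 h.2⟩
      rw [dif_pos h', dif_pos h]
      simp only [Sum.map_inl, Sum.inl.injEq, Prod.mk.injEq]
      constructor
      · apply Fin.ext; simp [hρval q.1 h.1]
      · apply Fin.ext; simp [hρval q.2 h.2]
    · have h' : ¬ (n ≤ ((ρ q.1 : Fin (n + g)) : ℕ) ∧ n ≤ ((ρ q.2 : Fin (n + g)) : ℕ)) := by
        rw [hρfree, hρfree]; exact h
      rw [dif_neg h', dif_neg h]
      simp only [Sum.map_inr, id_eq, Sum.inr.injEq]
      -- the pattern is `Bud`-invariant: `ρ` fixes ordered indices and preserves freeness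
      have hpat : pat (ρ q.1, ρ q.2) = pat q := by
        simp only [pat]
        by_cases h1 : (q.1 : ℕ) < n
        · have e1 : ρ q.1 = q.1 := hρfix q.1 h1
          by_cases h2 : (q.2 : ℕ) < n
          · have e2 : ρ q.2 = q.2 := hρfix q.2 h2
            rw [e1, e2]
          · have h2' : ¬ ((ρ q.2 : Fin (n + g)) : ℕ) < n := by
              rw [Nat.not_lt, hρfree]; omega
            rw [e1, if_pos h1, if_pos h1, if_neg h2', if_neg h2]
        · have h1' : ¬ ((ρ q.1 : Fin (n + g)) : ℕ) < n := by
            rw [Nat.not_lt, hρfree]; omega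
          have h2 : (q.2 : ℕ) < n := by omega
          have e2 : ρ q.2 = q.2 := hρfix q.2 h2
          rw [if_neg h1', if_neg h1, e2]
      rw [hpat]

/-- **Circuit transfer for HAM planting.** A `Bud(n+g, g)`-symmetric `tcBasis`-circuit on
`(n+g) × (n+g)` inputs yields a `Sym(Fin g)`-symmetric (square-symmetric) `tcBasis`-circuit on
`g × g` inputs with two more gates which takes, on the adjacency matrix of any `G`, the value of
the former on any planted HAM matrix of `G`. -/
theorem exists_hamCore (n g : ℕ) (C : Circuit (Fin (n + g) × Fin (n + g)))
    (hB : C.IsOver tcBasis) (hsym : C.IsSymmetricUnder (pointStabiliserBudget (n + g) g)) :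
    ∃ D : Circuit (Fin g × Fin g), D.IsOver tcBasis ∧ D.size = C.size + 2 ∧
      D.IsSymmetricUnder Set.univ ∧
      ∀ (G : SimpleGraph (Fin g)) (x : Fin (n + g) × Fin (n + g) → Bool),
        (∀ q : Fin (n + g) × Fin (n + g), ∀ h : n ≤ (q.1 : ℕ) ∧ n ≤ (q.2 : ℕ),
          x q = decide (G.Adj ⟨q.1 - n, by omega⟩ ⟨q.2 - n, by omega⟩)) →
        (∀ q : Fin (n + g) × Fin (n + g), (q.1 : ℕ) < n → (q.2 : ℕ) < n →
          x q = decide ((q.1 : ℕ) + 1 = q.2 ∨ (q.2 : ℕ) + 1 = q.1)) →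
        (∀ q : Fin (n + g) × Fin (n + g), (q.1 : ℕ) < n → n ≤ (q.2 : ℕ) →
          x q = decide ((q.1 : ℕ) = 0 ∨ (q.1 : ℕ) = n - 1)) →
        (∀ q : Fin (n + g) × Fin (n + g), n ≤ (q.1 : ℕ) → (q.2 : ℕ) < n →
          x q = decide ((q.2 : ℕ) = 0 ∨ (q.2 : ℕ) = n - 1)) →
        D.eval (fun p : Fin g × Fin g => decide (G.Adj p.1 p.2)) = C.eval x := by
  obtain ⟨φ, hφ2, hφv, hφσ⟩ := exists_hamWire n g
  obtain ⟨pre, hpreL, hpre0, hpreB, hpreV, hpreWF⟩ :=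
    HeaderHardwiring.exists_constPre (Fin g × Fin g)
  have hφ : WiresOK pre.length φ := by rw [hpreL]; exact hφ2
  obtain ⟨D, hDg, hDo⟩ := exists_hardwire₂ pre hpreWF C φ hφ
  refine ⟨D, isOver_hardwire₂ pre hpreB C D hB φ pre.length hDg, ?_, ?_, ?_⟩
  · rw [size_hardwire₂ pre C D φ pre.length hDg, hpreL]
  · intro σ _
    obtain ⟨ρ, hρfix, -, hρfree, hρval, hρbud⟩ := exists_extendPerm n σ
    obtain ⟨τ, hτ⟩ := hsym ρ hρbud
    exact exists_isInducedAut_hardwire₂ pre hpre0 C D φ hφ hDg hDo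
      (π := fun q : Fin (n + g) × Fin (n + g) => (ρ q.1, ρ q.2))
      (π' := fun p : Fin g × Fin g => (σ p.1, σ p.2)) (fun q => hφσ σ ρ hρfix hρfree hρval q) hτ
  · intro G x hFF hOO hOF hFO
    rw [eval_hardwire₂ pre C D φ hφ hDg hDo, hpreV]
    exact congrArg C.eval (funext fun q => hφv G x hFF hOO hOF hFO q)

/-- **The planted HAM matrices, packaged.** For `n ≥ 3` ordered and `g ≥ 1` free vertices there
is a planting `P : SimpleGraph (Fin g) → (m × m Boolean matrices)`, `m = n + g`, such that
(i) the route's graph `Gr (P G)` is Hamiltonian iff `G` has a Hamiltonian path (listing form),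
and (ii) every `Bud(m, g)`-symmetric `tcBasis`-circuit `C` on `m × m` inputs has a
square-symmetric `tcBasis`-circuit `D` on `g × g` inputs of size `|C| + 2` with
`D (adjacency matrix of G) = C (P G)` for all `G`. -/
theorem exists_hamPlant (n g : ℕ) (hn : 3 ≤ n) (hg : 1 ≤ g) :
    ∃ P : SimpleGraph (Fin g) → (Fin (n + g) × Fin (n + g) → Bool),
      (∀ G : SimpleGraph (Fin g),
        (SimpleGraph.fromRel fun u v => P G (u, v) = true).IsHamiltonian ↔
          ∃ l : List (Fin g), l.Nodup ∧ (∀ v, v ∈ l) ∧ List.IsChain G.Adj l) ∧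
      ∀ C : Circuit (Fin (n + g) × Fin (n + g)), C.IsOver tcBasis →
        C.IsSymmetricUnder (pointStabiliserBudget (n + g) g) →
        ∃ D : Circuit (Fin g × Fin g), D.IsOver tcBasis ∧ D.size = C.size + 2 ∧
          D.IsSymmetricUnder Set.univ ∧
          ∀ G : SimpleGraph (Fin g),
            D.eval (fun p : Fin g × Fin g => decide (G.Adj p.1 p.2)) = C.eval (P G) := by
  let P : SimpleGraph (Fin g) → (Fin (n + g) × Fin (n + g) → Bool) := fun G q =>
    if h : n ≤ (q.1 : ℕ) ∧ n ≤ (q.2 : ℕ) then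
      decide (G.Adj ⟨q.1 - n, by omega⟩ ⟨q.2 - n, by omega⟩)
    else if (q.1 : ℕ) < n then
      (if (q.2 : ℕ) < n then decide ((q.1 : ℕ) + 1 = q.2 ∨ (q.2 : ℕ) + 1 = q.1)
        else decide ((q.1 : ℕ) = 0 ∨ (q.1 : ℕ) = n - 1))
    else decide ((q.2 : ℕ) = 0 ∨ (q.2 : ℕ) = n - 1)
  have hFF : ∀ (G : SimpleGraph (Fin g)) (q : Fin (n + g) × Fin (n + g))
      (h : n ≤ (q.1 : ℕ) ∧ n ≤ (q.2 : ℕ)),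
      P G q = decide (G.Adj ⟨q.1 - n, by omega⟩ ⟨q.2 - n, by omega⟩) := fun G q h => by
    simp only [P]; rw [dif_pos h]
  have hOO : ∀ (G : SimpleGraph (Fin g)) (q : Fin (n + g) × Fin (n + g)),
      (q.1 : ℕ) < n → (q.2 : ℕ) < n →
      P G q = decide ((q.1 : ℕ) + 1 = q.2 ∨ (q.2 : ℕ) + 1 = q.1) := fun G q h1 h2 => by
    simp only [P]; rw [dif_neg (by omega), if_pos h1, if_pos h2]
  have hOF : ∀ (G : SimpleGraph (Fin g)) (q : Fin (n + g) × Fin (n + g)),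
      (q.1 : ℕ) < n → n ≤ (q.2 : ℕ) →
      P G q = decide ((q.1 : ℕ) = 0 ∨ (q.1 : ℕ) = n - 1) := fun G q h1 h2 => by
    simp only [P]; rw [dif_neg (by omega), if_pos h1, if_neg (by omega)]
  have hFO : ∀ (G : SimpleGraph (Fin g)) (q : Fin (n + g) × Fin (n + g)),
      n ≤ (q.1 : ℕ) → (q.2 : ℕ) < n →
      P G q = decide ((q.2 : ℕ) = 0 ∨ (q.2 : ℕ) = n - 1) := fun G q h1 h2 => by
    simp only [P]; rw [dif_neg (by omega), if_neg (by omega)]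
  refine ⟨P, fun G => isHamiltonian_gr_iff hn hg G (P G) (hFF G) (hOO G) (hOF G) (hFO G),
    fun C hB hsym => ?_⟩
  obtain ⟨D, hDB, hDs, hDsym, hDev⟩ := exists_hamCore n g C hB hsym
  exact ⟨D, hDB, hDs, hDsym, fun G => hDev G (P G) (hFF G) (hOO G) (hOF G) (hFO G)⟩

end Plant

end PolylogHam

end Summit.PneNP.PneNP.Theorems
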